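import Literature.Geometry.Kaehler.ComplexTorusChainPeriodsWeakLimit
import Literature.Geometry.Kaehler.AnalyticSetWeakConvergence
import Literature.Geometry.Kaehler.ComplexTorusChainIntegralPeriods
import Literature.Geometry.Kaehler.ComplexTorusAnalyticCycleClassProduct
import Literature.Geometry.GeometricMeasureTheory.DilationInvariance
import HarnessLib

/-!
# Classes of analytic subsets of a complex torus: stability under weak limits and finiteness under volume bounds

Layer `Literature/Geometry/Kaehler`; lane `lit-hodgefound`, seat p07, programme «BOUNDED CYCLES ON A
COMPLEX TORUS», file 2 (renamed for «bounded volume»). Let `X = E/Λ` (`Λ = Φ(ℤ^ι)`) be a complex torus and `Z ⊆ X` an analytic subset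
of pure dimension `p = d + 1`, with lift `π⁻¹ Z ⊆ E`, current `[π⁻¹ Z]` (`ComplexTorus.analyticChain`)
and class `[Z] ∈ H^k(X, ℂ)` (`ComplexTorus.analyticCycleClass`, `2p + k = rk Λ`), an INTEGRAL class
(`ComplexTorus.exists_int_analyticCyclePeriod_eq`: `∫_Z η ∈ ℤ` for `η ∈ H^{2p}(X, ℤ)`). This file
combines three facts of the tree — the integrality of the periods, the continuity of the periods
under weak convergence of the currents (`ComplexTorusChainPeriodsWeakLimit.lean`), and the compactness
theorem for analytic sets with locally bounded volumes (`AnalyticSetWeakConvergence.lean`,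
[Chirka1989, §16.1 Prop. 1; Fujiki1978, §2 Prop. 2.10 after Harvey–Shiffman]) — into:

* `ComplexTorus.eventually_analyticCycleClass_eq_of_tendsto_current` — **the class is eventually
  constant along a sequence of analytic subsets whose currents converge**: if `[π⁻¹ Z_j] → S` in the
  sense of currents then `[Z_j] = [Z_N]` for all `j ≥ N` (integral periods which converge are
  eventually constant; a class is determined by its periods on the lattice monomials,
  `eq_of_forall_poincarePairing_latMonomial_eq`); `…_of_tendsto` — `[Z_j] = [Z]` eventually when
  `S = [π⁻¹ Z]` (the homology class is locally constant on the space of cycles, [Fujiki1978, §4]);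
* `ComplexTorus.measure_preimage_cover_inter_le_of_isCompact` — **local volume bounds from the volume
  in a fundamental domain**: `𝓗^{2p}(π⁻¹Z ∩ K) ≤ N_K · 𝓗^{2p}(π⁻¹Z ∩ Φ([0,1)^ι))` with `N_K` the number
  of lattice translates of the period box needed to cover the compact `K` (periodicity of `π⁻¹Z`
  and translation invariance of `𝓗^{2p}`);
* `ComplexTorus.exists_subseq_tendsto_analyticChain` — **compactness**: analytic subsets `Z_j ⊆ X` of
  pure dimension `p` with `𝓗^{2p}(π⁻¹Z_j ∩ Φ([0,1)^ι)) ≤ M` have a subsequence whose currents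
  `[π⁻¹ Z_j]` converge to a positive holomorphic `p`-chain on `E` [Chirka1989, §16.1 Prop. 1 (2)];
* `ComplexTorus.finite_analyticCycleClass_of_measure_le` — **FINITENESS: the classes
  `[Z] ∈ H^k(X, ℂ)` of the analytic subsets `Z ⊆ X` of pure dimension `p` and volume
  `𝓗^{2p}(π⁻¹Z ∩ Φ([0,1)^ι)) ≤ M` form a finite set** (an infinite set of such classes would carry an
  injective sequence, a subsequence of which has convergent currents and hence an eventually
  constant class); `…_of_volume_le` — the same with the bound on the volume
  `vol(Z) = 𝓗^{2p}(Φ([0,1)^ι) ∩ reg π⁻¹Z) = ∫_Z ω^p/p!` of `analyticCyclePeriod_kaehlerPow`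
  ([Fujiki1978, §4 Prop. 4.1]: bounded families of cycles of a compact Kähler manifold; for
  projective `X` this is the finiteness of the classes of effective cycles of bounded degree).

Theorems only; no new definitions, no named facts.

## References

* [Chirka1989] E. M. Chirka, *Complex Analytic Sets*, Kluwer 1989, §15.5 (p. 205), §16.1 Prop. 1
  (pp. 206–207).
* [Fujiki1978] A. Fujiki, *Closedness of the Douady spaces of compact Kähler spaces*, Publ. RIMS 14
  (1978) 1–52, §2 Prop. 2.10 (with the theorem of Harvey–Shiffman), §4 Prop. 4.1.
* [VoisinHodgeI2002] C. Voisin, *Hodge Theory and Complex Algebraic Geometry I*, CUP 2002, §11.1.2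
  Cor. 11.15, Thm. 11.21.
* [Lange2023AbelianVarietiesComplex] H. Lange, *Abelian Varieties over the Complex Numbers*, Springer
  2023, §1.1.1, §1.1.4 Prop. 1.1.20.
* [Federer1969] H. Federer, *Geometric Measure Theory*, Springer 1969, 2.10.2, 4.1.7.
-/

noncomputable section

open scoped Manifold ENNReal NNReal Topology ContDiff Distributions
open MeasureTheory TopologicalSpace Set Function Filter Complex Metric
open Literature.Geometry.GeometricMeasureTheory

namespace Literature.Geometry.Kaehler

-- Nested operator-norm instances on `Covector V m` / `Multivector V m`, as in `Currents.lean`.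
set_option maxSynthPendingDepth 2

universe u

namespace ComplexTorus

/-! ## §0. Two elementary lemmas -/

section Elementary

/-- A convergent sequence of (complex numbers which are) integers is eventually equal to its limit.
[folklore] -/
private theorem eventually_eq_of_tendsto_of_forall_exists_int {u : ℕ → ℂ} {c : ℂ}
    (hu : ∀ j, ∃ z : ℤ, u j = z) (h : Tendsto u atTop (𝓝 c)) : ∀ᶠ j in atTop, u j = c := by
  choose z hz using hu
  have h1 : ∀ᶠ j in atTop, dist (u j) c < 1 / 2 := Metric.tendsto_nhds.1 h _ (by norm_num)
  obtain ⟨N, hN⟩ := eventually_atTop.1 h1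
  have hconst : ∀ j ≥ N, u j = u N := by
    intro j hj
    have hd : dist (u j) (u N) < 1 := by
      calc dist (u j) (u N) ≤ dist (u j) c + dist (u N) c := dist_triangle_right _ _ _
        _ < 1 / 2 + 1 / 2 := add_lt_add (hN j hj) (hN N le_rfl)
        _ = 1 := by norm_num
    rw [hz j, hz N] at hd ⊢
    rw [dist_eq_norm, ← Int.cast_sub, Complex.norm_intCast] at hd
    have h0 : |z j - z N| < 1 := by exact_mod_cast hd
    rw [sub_eq_zero.1 (Int.abs_lt_one_iff.1 h0)]
  have hlim : Tendsto u atTop (𝓝 (u N)) :=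
    tendsto_const_nhds.congr' (eventually_atTop.2 ⟨N, fun j hj ↦ (hconst j hj).symm⟩)
  have hc : c = u N := tendsto_nhds_unique h hlim
  exact eventually_atTop.2 ⟨N, fun j hj ↦ by rw [hconst j hj, hc]⟩

variable {ι : Type*} [Fintype ι] {E : Type u} [NormedAddCommGroup E] [InnerProductSpace ℂ E]
  (Φ : (ι → ℝ) ≃L[ℝ] E)

/-- **A compact set is covered by finitely many lattice translates of the period box** `Φ([0,1)^ι)`
(the coordinates are bounded on `K`; `x - Φ⌊Φ⁻¹x⌋` lies in the box).
[cite: Lange2023AbelianVarietiesComplex, §1.1.1] -/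
theorem exists_finset_subset_iUnion_latticeVec_add_periodBox {K : Set E} (hK : IsCompact K) :
    ∃ G : Finset (ι → ℤ), K ⊆ ⋃ m ∈ G, (fun y ↦ latticeVec Φ m + y) '' periodBox Φ 0 := by
  classical
  obtain ⟨C, hC⟩ := hK.exists_bound_of_continuousOn
    (f := fun x ↦ (Φ.symm : E → ι → ℝ) x) Φ.symm.continuous.continuousOn
  set N : ℕ := ⌈C⌉₊ + 1 with hN
  refine ⟨Fintype.piFinset fun _ ↦ Finset.Icc (-(N : ℤ)) N, fun x hx ↦ ?_⟩
  set m : ι → ℤ := fun i ↦ ⌊Φ.symm x i⌋ with hm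
  have hCN : C ≤ (⌈C⌉₊ : ℝ) := Nat.le_ceil C
  have hmG : m ∈ Fintype.piFinset fun _ ↦ Finset.Icc (-(N : ℤ)) N := by
    rw [Fintype.mem_piFinset]
    intro i
    rw [Finset.mem_Icc]
    have hi : |Φ.symm x i| ≤ C := by
      have h := (norm_le_pi_norm (Φ.symm x) i).trans (hC x hx)
      rwa [Real.norm_eq_abs] at h
    have habs := abs_le.1 hi
    have h1 : (m i : ℝ) ≤ Φ.symm x i := Int.floor_le _
    have h2 : Φ.symm x i < m i + 1 := Int.lt_floor_add_one _
    have hNr : (N : ℝ) = ⌈C⌉₊ + 1 := by simp [hN]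
    constructor
    · have : -(N : ℝ) ≤ m i := by rw [hNr]; linarith
      exact_mod_cast this
    · have : (m i : ℝ) ≤ (N : ℝ) := by rw [hNr]; linarith
      exact_mod_cast this
  refine mem_iUnion₂.2 ⟨m, hmG, ⟨x - latticeVec Φ m, ?_, add_sub_cancel (latticeVec Φ m) x⟩⟩
  rw [mem_periodBox_iff]
  intro i
  rw [map_sub, Pi.sub_apply, symm_latticeVec_apply, Pi.zero_apply, zero_add]
  exact ⟨by linarith [Int.floor_le (Φ.symm x i)], by linarith [Int.lt_floor_add_one (Φ.symm x i)]⟩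

variable [MeasurableSpace E] [BorelSpace E]

omit [Fintype ι] in
/-- **Local volume bounds from the volume in a fundamental domain.** For a `Λ`-periodic set `A ⊆ E`
and a compact `K`, covered by the translates `Φm + Φ([0,1)^ι)`, `m ∈ G`:
`𝓗^s(A ∩ K) ≤ #G · 𝓗^s(A ∩ Φ([0,1)^ι))` (periodicity of `A`, translation invariance of `𝓗^s`).
[cite: Federer1969, 2.10.2; Lange2023AbelianVarietiesComplex, §1.1.1] -/
theorem measure_inter_le_card_mul_of_periodic {s : ℕ} {A : Set E}
    (hA : ∀ m : ι → ℤ, (fun y ↦ latticeVec Φ m + y) ⁻¹' A = A) {K : Set E} {G : Finset (ι → ℤ)}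
    (hG : K ⊆ ⋃ m ∈ G, (fun y ↦ latticeVec Φ m + y) '' periodBox Φ 0) :
    (μHE[s] : Measure E) (A ∩ K) ≤ G.card * (μHE[s] : Measure E) (A ∩ periodBox Φ 0) := by
  -- each translate carries the same volume of `A` as the box
  have htr : ∀ m : ι → ℤ, (μHE[s] : Measure E) (A ∩ (fun y ↦ latticeVec Φ m + y) '' periodBox Φ 0) =
      (μHE[s] : Measure E) (A ∩ periodBox Φ 0) := by
    intro m
    have hinj : Injective fun y : E ↦ latticeVec Φ m + y := fun y y' h ↦ add_left_cancel h
    have himA : (fun y ↦ latticeVec Φ m + y) '' A = A := by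
      conv_lhs => rw [← hA m]
      exact image_preimage_eq _ fun y ↦ ⟨y - latticeVec Φ m, add_sub_cancel _ _⟩
    rw [← himA, ← image_inter hinj, himA]
    have h := euclideanHausdorffMeasure_image_add_smul (m := s) (latticeVec Φ m) one_pos (A ∩ periodBox Φ 0)
    simp only [one_smul, one_pow, ENNReal.ofReal_one, one_mul] at h
    exact h
  calc (μHE[s] : Measure E) (A ∩ K)
      ≤ (μHE[s] : Measure E) (⋃ m ∈ G, A ∩ (fun y ↦ latticeVec Φ m + y) '' periodBox Φ 0) := by
        refine measure_mono fun x hx ↦ ?_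
        obtain ⟨m, hm, hxm⟩ := mem_iUnion₂.1 (hG hx.2)
        exact mem_iUnion₂.2 ⟨m, hm, hx.1, hxm⟩
    _ ≤ ∑ m ∈ G, (μHE[s] : Measure E) (A ∩ (fun y ↦ latticeVec Φ m + y) '' periodBox Φ 0) :=
        measure_biUnion_finset_le _ _
    _ = G.card * (μHE[s] : Measure E) (A ∩ periodBox Φ 0) := by
        rw [Finset.sum_congr rfl fun m _ ↦ htr m, Finset.sum_const, nsmul_eq_mul]

/-- **Local volume bounds for the lift of an analytic subset of the torus**: for compact `K ⊆ E`
there is `N` (the number of lattice translates of the period box covering `K`) with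
`𝓗^s(π⁻¹Z ∩ K) ≤ N · 𝓗^s(π⁻¹Z ∩ Φ([0,1)^ι))` for EVERY `Z ⊆ X`.
[cite: Federer1969, 2.10.2; Lange2023AbelianVarietiesComplex, §1.1.1] -/
theorem measure_preimage_cover_inter_le_of_isCompact (s : ℕ) {K : Set E} (hK : IsCompact K) :
    ∃ N : ℕ, ∀ Z : Set (ComplexTorus Φ), (μHE[s] : Measure E) (cover Φ ⁻¹' Z ∩ K) ≤
      N * (μHE[s] : Measure E) (cover Φ ⁻¹' Z ∩ periodBox Φ 0) := by
  obtain ⟨G, hG⟩ := exists_finset_subset_iUnion_latticeVec_add_periodBox Φ hK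
  exact ⟨G.card, fun Z ↦ measure_inter_le_card_mul_of_periodic Φ
    (const_add_preimage_cover_preimage Φ Z) hG⟩

end Elementary

/-! ## §1. The class is eventually constant along weakly convergent sequences -/

section Stability

variable {ι : Type*} [Fintype ι] [DecidableEq ι] {E : Type u} [NormedAddCommGroup E]
  [InnerProductSpace ℂ E] [FiniteDimensional ℂ E] [MeasurableSpace E] [BorelSpace E]
  (Φ : (ι → ℝ) ≃L[ℝ] E) {d n k : ℕ} (e : Fin n ≃ ι) (h : 2 * (d + 1) + k = n)
  {Z : ℕ → Set (ComplexTorus Φ)} (hZ : ∀ j, HasPureDim 𝓘(ℂ, E) (Z j) (d + 1))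

/-- **Integral periods which converge are eventually constant**: if `[π⁻¹ Z_j] → S` in the sense of
currents then, for every integral class `η ∈ H^{2p}(X, ℤ)`, the integers `∫_{Z_j} η` are eventually
equal to their limit. [cite: Fujiki1978, §2 Prop. 2.10 and §4; VoisinHodgeI2002, §11.1.2 Thm. 11.21] -/
theorem eventually_analyticCyclePeriod_eq_of_tendsto_current {S : Current (⊤ : Opens E) (2 * (d + 1))}
    (hconv : ∀ ψ, Tendsto (fun j ↦ (analyticChain Φ (hZ j)).toCurrent ψ) atTop (𝓝 (S ψ)))
    {η : E [⋀^Fin (2 * (d + 1))]→L[ℝ] ℂ} (hη : η ∈ integralForms Φ (2 * (d + 1))) :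
    ∃ c : ℂ, ∀ᶠ j in atTop, analyticCyclePeriod Φ (hZ j) η = c := by
  obtain ⟨χ, hχ⟩ := exists_testFunction_eq_weight Φ
  exact ⟨_, eventually_eq_of_tendsto_of_forall_exists_int
    (fun j ↦ exists_int_analyticCyclePeriod_eq Φ (hZ j) hη)
    (tendsto_analyticCyclePeriod_of_tendsto_current Φ hZ hχ hconv η)⟩

/-- **The class `[Z_j]` is eventually constant when the currents `[π⁻¹ Z_j]` converge** (to any
current): there is `N` with `[Z_j] = [Z_N]` for all `j ≥ N` — the finitely many integral periods on
the lattice monomials are eventually constant, and they determine the class.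
[cite: Fujiki1978, §4 Prop. 4.1; Lange2023AbelianVarietiesComplex, §1.1.4 Prop. 1.1.20] -/
theorem eventually_analyticCycleClass_eq_of_tendsto_current {S : Current (⊤ : Opens E) (2 * (d + 1))}
    (hconv : ∀ ψ, Tendsto (fun j ↦ (analyticChain Φ (hZ j)).toCurrent ψ) atTop (𝓝 (S ψ))) :
    ∃ N, ∀ j ≥ N, analyticCycleClass Φ e h (hZ j) = analyticCycleClass Φ e h (hZ N) := by
  have hw : ∀ w : Fin (2 * (d + 1)) → ι, ∃ c : ℂ, ∀ᶠ j in atTop,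
      analyticCyclePeriod Φ (hZ j) (latMonomial Φ (2 * (d + 1)) w) = c := fun w ↦
    eventually_analyticCyclePeriod_eq_of_tendsto_current Φ hZ hconv (latMonomial_mem_integralForms Φ _ w)
  choose c hc using hw
  have hall : ∀ᶠ j in atTop, ∀ w : Fin (2 * (d + 1)) → ι,
      analyticCyclePeriod Φ (hZ j) (latMonomial Φ (2 * (d + 1)) w) = c w :=
    eventually_all.2 hc
  obtain ⟨N, hN⟩ := eventually_atTop.1 hall
  refine ⟨N, fun j hj ↦ eq_of_forall_poincarePairing_latMonomial_eq Φ e h fun w ↦ ?_⟩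
  rw [poincarePairing_analyticCycleClass, poincarePairing_analyticCycleClass, hN j hj w, hN N le_rfl w]

/-- **`[Z_j] = [Z]` eventually when `[π⁻¹ Z_j] → [π⁻¹ Z]`** in the sense of currents (the homology
class is locally constant on the space of cycles). [cite: Fujiki1978, §4 Prop. 4.1; VoisinHodgeI2002, §11.1.2 Cor. 11.15] -/
theorem eventually_analyticCycleClass_eq_of_tendsto {Z' : Set (ComplexTorus Φ)}
    (hZ' : HasPureDim 𝓘(ℂ, E) Z' (d + 1))
    (hconv : ∀ ψ, Tendsto (fun j ↦ (analyticChain Φ (hZ j)).toCurrent ψ) atTop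
      (𝓝 ((analyticChain Φ hZ').toCurrent ψ))) :
    ∀ᶠ j in atTop, analyticCycleClass Φ e h (hZ j) = analyticCycleClass Φ e h hZ' := by
  have hw : ∀ w : Fin (2 * (d + 1)) → ι, ∀ᶠ j in atTop,
      analyticCyclePeriod Φ (hZ j) (latMonomial Φ (2 * (d + 1)) w) =
        analyticCyclePeriod Φ hZ' (latMonomial Φ (2 * (d + 1)) w) := fun w ↦
    eventually_eq_of_tendsto_of_forall_exists_int
      (fun j ↦ exists_int_analyticCyclePeriod_eq Φ (hZ j) (latMonomial_mem_integralForms Φ _ w))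
      (tendsto_analyticCyclePeriod_of_tendsto Φ hZ hZ' hconv _)
  filter_upwards [eventually_all.2 hw] with j hj
  refine eq_of_forall_poincarePairing_latMonomial_eq Φ e h fun w ↦ ?_
  rw [poincarePairing_analyticCycleClass, poincarePairing_analyticCycleClass, hj w]

end Stability

/-! ## §2. Compactness and finiteness under a volume bound -/

section Finiteness

variable {ι : Type*} [Fintype ι] [DecidableEq ι] {E : Type u} [NormedAddCommGroup E]
  [InnerProductSpace ℂ E] [FiniteDimensional ℂ E] [MeasurableSpace E] [BorelSpace E]
  (Φ : (ι → ℝ) ≃L[ℝ] E) {d : ℕ}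

omit [DecidableEq ι] in
/-- **Compactness for analytic subsets of bounded volume** [Chirka1989, §16.1 Prop. 1 (2); Fujiki1978,
§2 Prop. 2.10]: if the `Z_j ⊆ X` are analytic of pure dimension `p = d + 1` with
`𝓗^{2p}(π⁻¹Z_j ∩ Φ([0,1)^ι)) ≤ M < ∞`, then the lifts have locally uniformly bounded volumes, so a
subsequence of the currents `[π⁻¹ Z_j]` converges, in the sense of currents, to a positive holomorphic
`p`-chain on `E`. [cite: Chirka1989, §16.1 Prop. 1 (2), pp. 206–207; Fujiki1978, §2 Prop. 2.10] -/
theorem exists_subseq_tendsto_analyticChain {Z : ℕ → Set (ComplexTorus Φ)}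
    (hZ : ∀ j, HasPureDim 𝓘(ℂ, E) (Z j) (d + 1)) {M : ℝ≥0∞} (hM : M < ⊤)
    (hvol : ∀ j, (μHE[2 * (d + 1)] : Measure E) (cover Φ ⁻¹' Z j ∩ periodBox Φ 0) ≤ M) :
    ∃ (T : HolomorphicChain 𝓘(ℂ, E) (⊤ : Opens E) (d + 1)) (κ : ℕ → ℕ), StrictMono κ ∧
      (∀ ψ, Tendsto (fun j ↦ (analyticChain Φ (hZ (κ j))).toCurrent ψ) atTop (𝓝 (T.toCurrent ψ))) ∧
      ∀ Y, 0 ≤ T.mult Y := by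
  refine exists_subseq_tendsto_toCurrent_ofSet (fun j ↦ hasPureDim_liftSet Φ (hZ j)) fun K hK _ ↦ ?_
  obtain ⟨N, hN⟩ := measure_preimage_cover_inter_le_of_isCompact Φ (2 * (d + 1)) hK
  refine ⟨N * M, ENNReal.mul_lt_top (by simp) hM, fun j ↦ ?_⟩
  rw [image_val_liftSet]
  calc (μHE[2 * (d + 1)] : Measure E) (cover Φ ⁻¹' Z j ∩ K)
      ≤ N * (μHE[2 * (d + 1)] : Measure E) (cover Φ ⁻¹' Z j ∩ periodBox Φ 0) := hN (Z j)
    _ ≤ N * M := by gcongr; exact hvol j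

variable {n k : ℕ} (e : Fin n ≃ ι) (h : 2 * (d + 1) + k = n)

/-- **FINITENESS OF THE CLASSES OF ANALYTIC SUBSETS OF BOUNDED VOLUME.** For `M < ∞`, the classes
`[Z] ∈ H^k(X, ℂ)` of the analytic subsets `Z ⊆ X = E/Λ` of pure dimension `p = d + 1` with
`𝓗^{2p}(π⁻¹Z ∩ Φ([0,1)^ι)) ≤ M` form a FINITE set: an infinite set of such classes contains an injective
sequence `[Z_j]`; a subsequence of the currents `[π⁻¹ Z_j]` converges (compactness), along which the
class is eventually constant (integrality) — a contradiction.
[cite: Fujiki1978, §4 Prop. 4.1 and §2 Prop. 2.10; Chirka1989, §16.1 Prop. 1 (2)] -/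
theorem finite_analyticCycleClass_of_measure_le {M : ℝ≥0∞} (hM : M < ⊤) :
    {c : E [⋀^Fin k]→L[ℝ] ℂ | ∃ (Z : Set (ComplexTorus Φ)) (hZ : HasPureDim 𝓘(ℂ, E) Z (d + 1)),
      (μHE[2 * (d + 1)] : Measure E) (cover Φ ⁻¹' Z ∩ periodBox Φ 0) ≤ M ∧
        analyticCycleClass Φ e h hZ = c}.Finite := by
  by_contra hinf
  rw [Set.not_finite] at hinf
  -- an injective sequence of classes in the set
  set f := hinf.natEmbedding _ with hf
  have hmem : ∀ j, ∃ (Z : Set (ComplexTorus Φ)) (hZ : HasPureDim 𝓘(ℂ, E) Z (d + 1)),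
      (μHE[2 * (d + 1)] : Measure E) (cover Φ ⁻¹' Z ∩ periodBox Φ 0) ≤ M ∧
        analyticCycleClass Φ e h hZ = (f j : E [⋀^Fin k]→L[ℝ] ℂ) := fun j ↦ (f j).2
  choose Z hZ hvol hcl using hmem
  -- a convergent subsequence of the currents
  obtain ⟨T, κ, hκ, hconv, -⟩ := exists_subseq_tendsto_analyticChain Φ hZ hM hvol
  -- along it the class is eventually constant
  obtain ⟨N, hN⟩ := eventually_analyticCycleClass_eq_of_tendsto_current Φ e h (fun j ↦ hZ (κ j)) hconv
  have heq : f (κ (N + 1)) = f (κ N) := by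
    apply Subtype.ext
    rw [← hcl (κ (N + 1)), ← hcl (κ N)]
    exact hN (N + 1) (Nat.le_succ N)
  have hne : κ (N + 1) ≠ κ N := (hκ (Nat.lt_succ_self N)).ne'
  exact hne (f.injective heq)

/-- **Finiteness under a bound on the volume `vol(Z) = ∫_Z ω^p/p!`** (the real number
`𝓗^{2p}(Φ([0,1)^ι) ∩ reg π⁻¹Z)` of `analyticCyclePeriod_kaehlerPow`): the classes of the analytic
subsets of pure dimension `p = d + 1` with `vol(Z) ≤ M` form a finite set.
[cite: Fujiki1978, §4 Prop. 4.1 and §2 Prop. 2.10; Chirka1989, §13.3 Cor. and §16.1 Prop. 1 (2)] -/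
theorem finite_analyticCycleClass_of_volume_le (M : ℝ) :
    {c : E [⋀^Fin k]→L[ℝ] ℂ | ∃ (Z : Set (ComplexTorus Φ)) (hZ : HasPureDim 𝓘(ℂ, E) Z (d + 1)),
      (μHE[2 * (d + 1)] : Measure E).real (periodBox Φ 0 ∩ (analyticChain Φ hZ).carrier) ≤ M ∧
        analyticCycleClass Φ e h hZ = c}.Finite := by
  refine (finite_analyticCycleClass_of_measure_le Φ e h (M := ENNReal.ofReal M) ENNReal.ofReal_lt_top).subset
    ?_
  rintro c ⟨Z, hZ, hvol, rfl⟩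
  refine ⟨Z, hZ, ?_, rfl⟩
  -- `𝓗^{2p}(π⁻¹Z ∩ box) = 𝓗^{2p}(box ∩ reg π⁻¹Z) < ∞`
  have heq : (μHE[2 * (d + 1)] : Measure E) (cover Φ ⁻¹' Z ∩ periodBox Φ 0) =
      (μHE[2 * (d + 1)] : Measure E) (periodBox Φ 0 ∩ (analyticChain Φ hZ).carrier) := by
    rw [← image_val_liftSet, analyticChain,
      HolomorphicChain.measure_image_inter_eq_carrier_inter (hasPureDim_liftSet Φ hZ), inter_comm]
  have hlt : (μHE[2 * (d + 1)] : Measure E) (periodBox Φ 0 ∩ (analyticChain Φ hZ).carrier) < ⊤ := by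
    rw [inter_comm]
    exact lt_of_le_of_lt (measure_mono (inter_subset_inter_right _ (periodBox_subset_closedPeriodBox Φ 0)))
      ((analyticChain Φ hZ).measure_carrier_inter_lt_top (isCompact_closedPeriodBox Φ 0)
        fun _ _ ↦ trivial)
  rw [heq]
  exact (ENNReal.le_ofReal_iff_toReal_le hlt.ne (le_trans ENNReal.toReal_nonneg hvol)).2 hvol

end Finiteness

end ComplexTorus

end Literature.Geometry.Kaehler

end
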